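import Literature.Computability.MetaComplexity.ResolutionWidth
import Mathlib.Combinatorics.Enumerative.DoubleCounting
import Mathlib.Analysis.SpecialFunctions.Exp
import HarnessLib

/-!
# The Ben-Sasson–Wigderson size–width relation for general resolution

**BSW Theorem 3.5 / Corollary 3.6** (Ben-Sasson–Wigderson 2001): a CNF `F` of width `k` over
`n` variables with a (dag-like) resolution refutation of size `S` has a refutation of width
`≤ k + d + a` whenever `S · (1 - d/2n)^a < 1`; hence `S ≥ exp(a d / 2n)` if no refutation of
width `k + d + a` exists (`exp_le_length_of_not_derivable`), i.e.
`S = exp(Ω((w(F ⊢ 0) - w(F))² / n))`.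

The proof is BSW's: induction on the number of unassigned variables; if some clause of the
restricted refutation is `d`-fat, a literal hitting a `d/2n` fraction of the fat clauses exists by
pigeonhole (`exists_literal_cover`); setting it true kills those clauses, setting it false keeps
the count, and BSW Lemma 3.2 (`ResDerivable.of_split`) recombines the two branches. Refutations are
the tree's list refutations (`IsResRefutation`), accessed only through
`resDerivable_restrict_of_isResRefutation`; widths are measured by `ResDerivable` (`ResolutionWidth`).

## References

* E. Ben-Sasson, A. Wigderson, *Short proofs are narrow — resolution made simple*, J. ACM 48
  (2001) 149–169, Theorem 3.5, Corollary 3.6.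
-/

namespace Literature.Computability.MetaComplexity

open Finset Literature.Computability.Complexity

variable {ν : Type*} [DecidableEq ν]

/-- Assigning a fresh variable: the unassigned variables afterwards. [folklore] -/
theorem update_some_eq_none_iff {ρ : ν → Option Bool} {x v : ν} {b : Bool} :
    Function.update ρ x (some b) v = none ↔ v ≠ x ∧ ρ v = none := by
  by_cases h : v = x
  · subst h; simp
  · simp [h]

/-- Fat clauses only shrink under further restriction. [Ben-Sasson–Wigderson 2001, proof of
Thm 3.5] [folklore] -/
theorem IsFat.of_update {d : ℕ} {ρ : ν → Option Bool} {x : ν} (hx : ρ x = none) {b : Bool}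
    {C : Finset (Literal ν)} (h : IsFat d (Function.update ρ x (some b)) C) : IsFat d ρ C :=
  ⟨fun hs => h.1 (hs.update hx),
    h.2.trans_le (Finset.card_le_card (restrictClause_update_subset hx))⟩

/-- A fat clause of `ρ[x:=b]` does not contain the literal `x^b` (it would be satisfied).
[Ben-Sasson–Wigderson 2001, proof of Thm 3.5] [folklore] -/
theorem IsFat.not_mem_of_update {d : ℕ} {ρ : ν → Option Bool} {x : ν} {b : Bool}
    {C : Finset (Literal ν)} (h : IsFat d (Function.update ρ x (some b)) C) :
    (x, b) ∉ restrictClause ρ C := fun hl =>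
  h.1 ⟨(x, b), restrictClause_subset hl, by simp⟩

/-- **Pigeonhole step of BSW Thm 3.5.** If some clause is `d`-fat under `ρ` and all unassigned
variables lie in `V` (`M` of them), some literal `l` on an unassigned variable lies in at least a
`d / 2M` fraction of the fat restricted clauses: `d · #fat ≤ 2M · #{fat clauses containing l}`.
[Ben-Sasson–Wigderson 2001, proof of Thm 3.5] [folklore] -/
theorem exists_literal_cover {ι : Type*} [Fintype ι] (Λ : ι → Finset (Literal ν)) (V : Finset ν)
    (d : ℕ) (ρ : ν → Option Bool) (hρV : ∀ v, ρ v = none → v ∈ V)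
    (hne : (univ.filter fun i => IsFat d ρ (Λ i)).Nonempty) :
    ∃ l : Literal ν, ρ l.1 = none ∧
      d * (univ.filter fun i => IsFat d ρ (Λ i)).card ≤
        2 * (V.filter fun v => ρ v = none).card *
          (univ.filter fun i => IsFat d ρ (Λ i) ∧ l ∈ restrictClause ρ (Λ i)).card := by
  classical
  set S := univ.filter fun i => IsFat d ρ (Λ i) with hS
  set T : Finset (Literal ν) := (V.filter fun v => ρ v = none) ×ˢ (univ : Finset Bool) with hT
  have hsubT : ∀ i, restrictClause ρ (Λ i) ⊆ T := by
    intro i l hl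
    obtain ⟨-, hρl⟩ := mem_restrictClause.1 hl
    rw [hT, Finset.mem_product]
    exact ⟨Finset.mem_filter.2 ⟨hρV _ hρl, hρl⟩, Finset.mem_univ _⟩
  have hcardT : T.card = 2 * (V.filter fun v => ρ v = none).card := by
    rw [hT, Finset.card_product]; simp [mul_comm]
  -- double counting of the incidences (fat clause, literal in its restriction)
  have hdc := Finset.sum_card_bipartiteAbove_eq_sum_card_bipartiteBelow
    (fun i (l : Literal ν) => l ∈ restrictClause ρ (Λ i)) (s := S) (t := T)
  have habove : ∀ i, (T.bipartiteAbove (fun i (l : Literal ν) => l ∈ restrictClause ρ (Λ i)) i)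
      = restrictClause ρ (Λ i) := by
    intro i
    ext l
    simp only [Finset.bipartiteAbove, Finset.mem_filter]
    exact ⟨fun h => h.2, fun h => ⟨hsubT i h, h⟩⟩
  simp only [habove] at hdc
  -- total incidences ≥ d · |S|
  have hlow : d * S.card ≤ ∑ i ∈ S, (restrictClause ρ (Λ i)).card := by
    rw [mul_comm, Finset.card_eq_sum_ones, Finset.sum_mul]
    refine Finset.sum_le_sum fun i hi => ?_
    rw [hS, Finset.mem_filter] at hi
    simpa using hi.2.2.le
  have hTne : T.Nonempty := by
    obtain ⟨i, hi⟩ := hne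
    rw [Finset.mem_filter] at hi
    obtain ⟨l, hl⟩ : (restrictClause ρ (Λ i)).Nonempty := by
      rw [← Finset.card_pos]; exact lt_of_le_of_lt (Nat.zero_le _) hi.2.2
    exact ⟨l, hsubT i hl⟩
  -- averaging over the literals of T
  obtain ⟨l, hlT, hl⟩ := Finset.exists_le_of_sum_le hTne (f := fun _ => d * S.card)
    (g := fun l => T.card *
      (S.bipartiteBelow (fun i (l : Literal ν) => l ∈ restrictClause ρ (Λ i)) l).card) (by
    rw [Finset.sum_const, smul_eq_mul, ← Finset.mul_sum, ← hdc]
    exact Nat.mul_le_mul_left _ hlow)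
  refine ⟨l, ?_, ?_⟩
  · rw [hT, Finset.mem_product, Finset.mem_filter] at hlT
    exact hlT.1.2
  · rw [hcardT] at hl
    have hQ : S.bipartiteBelow (fun i (l : Literal ν) => l ∈ restrictClause ρ (Λ i)) l =
        univ.filter fun i => IsFat d ρ (Λ i) ∧ l ∈ restrictClause ρ (Λ i) := by
      ext i
      simp only [Finset.mem_bipartiteBelow, hS, Finset.mem_filter, Finset.mem_univ, true_and]
    rwa [hQ] at hl

/-- **BSW Theorem 3.5, inductive form.** Let `F` have width `≤ k`, let `Λ` be a finite family of
clauses such that, under every restriction `ρ` assigning all variables outside `V`, the empty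
clause is `W`-derivable from `F|ρ` as soon as all non-satisfied restricted `Λ`-clauses have width
`≤ W` (for `Λ` = the lines of a refutation this is `resDerivable_restrict_of_isResRefutation`), and
let `d ≤ 2|V|`. If `ρ` leaves at most `N` variables of `V` unassigned and the number of `d`-fat
`Λ`-clauses under `ρ` is `< (1 - d/2|V|)^{-a}`, then `F|ρ ⊢_{d+a+k} 0`.
[Ben-Sasson–Wigderson 2001, Thm 3.5 (proof)] [cite: BenSassonWigderson2001, Thm 3.5] -/
theorem derivable_of_fat_lt {ι : Type*} [Fintype ι] (F : Set (Finset (Literal ν)))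
    (Λ : ι → Finset (Literal ν)) (V : Finset ν) {k d : ℕ}
    (hF : ∀ D ∈ F, D.card ≤ k) (hd : d ≤ 2 * V.card)
    (hR : ∀ ρ : ν → Option Bool, (∀ v, ρ v = none → v ∈ V) → ∀ W : ℕ,
      (∀ i, ¬ SatisfiedBy ρ (Λ i) → (restrictClause ρ (Λ i)).card ≤ W) →
      ResDerivable (restrictFormula ρ F) W ∅) :
    ∀ (N : ℕ) (ρ : ν → Option Bool), (∀ v, ρ v = none → v ∈ V) →
      (V.filter fun v => ρ v = none).card ≤ N → ∀ a : ℕ,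
      ((univ.filter fun i => IsFat d ρ (Λ i)).card : ℝ) * (1 - d / (2 * V.card)) ^ a < 1 →
      ResDerivable (restrictFormula ρ F) (d + a + k) ∅ := by
  classical
  -- the case without fat clauses, used twice
  have hnofat : ∀ ρ : ν → Option Bool, (∀ v, ρ v = none → v ∈ V) →
      (univ.filter fun i => IsFat d ρ (Λ i)) = ∅ → ∀ a, ResDerivable (restrictFormula ρ F) (d + a + k) ∅ := by
    intro ρ hρV h0 a
    refine (hR ρ hρV d fun i hns => ?_).mono (by omega)
    by_contra hlt
    push Not at hlt
    have : i ∈ univ.filter fun i => IsFat d ρ (Λ i) := Finset.mem_filter.2 ⟨mem_univ _, hns, hlt⟩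
    rw [h0] at this
    simp at this
  have hθ0 : (0 : ℝ) ≤ 1 - d / (2 * V.card) := by
    rcases Nat.eq_zero_or_pos V.card with hV | hV
    · have : d = 0 := by omega
      simp [hV, this]
    · rw [sub_nonneg, div_le_one (by positivity)]
      exact_mod_cast hd
  intro N
  induction N with
  | zero =>
    intro ρ hρV hfree a _
    refine hnofat ρ hρV ?_ a
    rw [Finset.filter_eq_empty_iff]
    intro i _ hfat
    obtain ⟨l, hl⟩ : (restrictClause ρ (Λ i)).Nonempty := by
      rw [← Finset.card_pos]; exact lt_of_le_of_lt (Nat.zero_le _) hfat.2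
    obtain ⟨-, hρl⟩ := mem_restrictClause.1 hl
    have hmem : l.1 ∈ V.filter fun v => ρ v = none := Finset.mem_filter.2 ⟨hρV _ hρl, hρl⟩
    rw [Nat.le_zero, Finset.card_eq_zero] at hfree
    rw [hfree] at hmem
    simp at hmem
  | succ N ih =>
    intro ρ hρV hfree a hfat
    set S := univ.filter fun i => IsFat d ρ (Λ i) with hS
    rcases S.eq_empty_or_nonempty with hS0 | hSne
    · exact hnofat ρ hρV hS0 a
    -- `a ≥ 1` since `|S| ≥ 1` and `|S| θ^a < 1`
    obtain ⟨a, rfl⟩ : ∃ a', a = a' + 1 := by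
      rcases a with _ | a'
      · exfalso
        rw [pow_zero, mul_one] at hfat
        have : (1 : ℝ) ≤ S.card := by exact_mod_cast Finset.card_pos.2 hSne
        linarith
      · exact ⟨a', rfl⟩
    -- the covering literal
    obtain ⟨⟨x, c⟩, hx, hcount⟩ := exists_literal_cover Λ V d ρ hρV hSne
    simp only at hx
    set M := (V.filter fun v => ρ v = none).card with hM
    set Q := univ.filter fun i => IsFat d ρ (Λ i) ∧ (x, c) ∈ restrictClause ρ (Λ i) with hQ
    have hxV : x ∈ V := hρV x hx
    have hMpos : 0 < M := Finset.card_pos.2 ⟨x, Finset.mem_filter.2 ⟨hxV, hx⟩⟩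
    have hMV : M ≤ V.card := Finset.card_le_card (Finset.filter_subset _ _)
    have hQS : Q ⊆ S := fun i hi => by
      rw [hQ, Finset.mem_filter] at hi
      exact Finset.mem_filter.2 ⟨hi.1, hi.2.1⟩
    -- the two one-variable extensions
    set ρ₁ := Function.update ρ x (some c) with hρ₁
    set ρ₀ := Function.update ρ x (some !c) with hρ₀
    have hV' : ∀ b : Bool, ∀ v, Function.update ρ x (some b) v = none → v ∈ V :=
      fun b v hv => hρV v (update_some_eq_none_iff.1 hv).2
    have hfree' : ∀ b : Bool,
        (V.filter fun v => Function.update ρ x (some b) v = none).card ≤ N := by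
      intro b
      have hsub : (V.filter fun v => Function.update ρ x (some b) v = none) ⊆
          (V.filter fun v => ρ v = none).erase x := by
        intro v hv
        rw [Finset.mem_filter] at hv
        obtain ⟨hvx, hρv⟩ := update_some_eq_none_iff.1 hv.2
        exact Finset.mem_erase.2 ⟨hvx, Finset.mem_filter.2 ⟨hv.1, hρv⟩⟩
      refine (Finset.card_le_card hsub).trans ?_
      rw [Finset.card_erase_of_mem (Finset.mem_filter.2 ⟨hxV, hx⟩)]
      omega
    -- fat clauses under the extensions
    have hS₀ : (univ.filter fun i => IsFat d ρ₀ (Λ i)) ⊆ S := fun i hi => by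
      rw [Finset.mem_filter] at hi ⊢
      exact ⟨hi.1, hi.2.of_update hx⟩
    have hS₁ : (univ.filter fun i => IsFat d ρ₁ (Λ i)) ⊆ S \ Q := fun i hi => by
      rw [Finset.mem_filter] at hi
      rw [Finset.mem_sdiff]
      refine ⟨Finset.mem_filter.2 ⟨hi.1, hi.2.of_update hx⟩, fun hiQ => ?_⟩
      rw [hQ, Finset.mem_filter] at hiQ
      exact hi.2.not_mem_of_update hiQ.2.2
    -- real arithmetic
    set θ : ℝ := 1 - d / (2 * V.card) with hθ
    have hVpos : (0 : ℝ) < V.card := by exact_mod_cast lt_of_lt_of_le hMpos hMV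
    have hcountR : (d : ℝ) * S.card ≤ 2 * M * Q.card := by exact_mod_cast hcount
    have hq : (d : ℝ) / (2 * V.card) * S.card ≤ Q.card := by
      have hM' : (0 : ℝ) < M := by exact_mod_cast hMpos
      have hMV' : (M : ℝ) ≤ V.card := by exact_mod_cast hMV
      rw [div_mul_eq_mul_div, div_le_iff₀ (by positivity)]
      calc (d : ℝ) * S.card ≤ 2 * M * Q.card := hcountR
        _ ≤ Q.card * (2 * V.card) := by nlinarith [Q.card.cast_nonneg (α := ℝ)]
    have h1 : ((univ.filter fun i => IsFat d ρ₁ (Λ i)).card : ℝ) * θ ^ a < 1 := by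
      have hle : ((univ.filter fun i => IsFat d ρ₁ (Λ i)).card : ℝ) ≤ S.card - Q.card := by
        have := Finset.card_le_card hS₁
        rw [Finset.card_sdiff_of_subset hQS] at this
        have hQle : Q.card ≤ S.card := Finset.card_le_card hQS
        rw [← Nat.cast_sub hQle]
        exact_mod_cast this
      have hle' : (S.card : ℝ) - Q.card ≤ S.card * θ := by
        rw [hθ, mul_sub, mul_one]
        linarith
      calc ((univ.filter fun i => IsFat d ρ₁ (Λ i)).card : ℝ) * θ ^ a
          ≤ (S.card * θ) * θ ^ a := by
            exact mul_le_mul_of_nonneg_right (hle.trans hle') (pow_nonneg hθ0 _)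
        _ = S.card * θ ^ (a + 1) := by ring
        _ < 1 := hfat
    have h0 : ((univ.filter fun i => IsFat d ρ₀ (Λ i)).card : ℝ) * θ ^ (a + 1) < 1 := by
      calc ((univ.filter fun i => IsFat d ρ₀ (Λ i)).card : ℝ) * θ ^ (a + 1)
          ≤ S.card * θ ^ (a + 1) := by
            refine mul_le_mul_of_nonneg_right ?_ (pow_nonneg hθ0 _)
            exact_mod_cast Finset.card_le_card hS₀
        _ < 1 := hfat
    have hd₁ := ih ρ₁ (hV' c) (hfree' c) a h1
    have hd₀ := ih ρ₀ (hV' !c) (hfree' !c) (a + 1) h0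
    have e1 : d + (a + 1) + k = d + a + k + 1 := by omega
    rw [e1] at hd₀ ⊢
    exact ResDerivable.of_split hx (fun D hD => (hF D hD).trans (by omega)) hd₁ hd₀

/-- **BSW Theorem 3.5 for the tree's refutations.** If `φ` (width `≤ k`, variables in `V`,
`d ≤ 2|V|`) has NO width-`(d + a + k)` derivation of the empty clause, then every resolution
refutation `π` of `φ` satisfies `|π| · (1 - d/2|V|)^a ≥ 1`.
[Ben-Sasson–Wigderson 2001, Thm 3.5] [cite: BenSassonWigderson2001, Thm 3.5] -/
theorem one_le_length_mul_pow_of_not_derivable {φ : CNF ν} {π : List (ResLine ν)}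
    (hπ : IsResRefutation φ π) (V : Finset ν) (hφV : ∀ c ∈ φ, ∀ l ∈ c, l.1 ∈ V) {k : ℕ}
    (hk : ∀ D ∈ clauseSet φ, D.card ≤ k) {d : ℕ} (a : ℕ) (hd : d ≤ 2 * V.card)
    (hnd : ¬ ResDerivable (clauseSet φ) (d + a + k) ∅) :
    1 ≤ (π.length : ℝ) * (1 - d / (2 * V.card)) ^ a := by
  classical
  by_contra hlt
  push Not at hlt
  set ρ₀ : ν → Option Bool := fun v => if v ∈ V then none else some false with hρ₀
  have hρ₀none : ∀ v, ρ₀ v = none ↔ v ∈ V := fun v => by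
    rw [hρ₀]; dsimp only; split_ifs with h <;> simp [h]
  have hR : ∀ ρ : ν → Option Bool, (∀ v, ρ v = none → v ∈ V) → ∀ W : ℕ,
      (∀ i : Fin π.length, ¬ SatisfiedBy ρ (π[i]).clause →
        (restrictClause ρ (π[i]).clause).card ≤ W) →
      ResDerivable (restrictFormula ρ (clauseSet φ)) W ∅ := by
    intro ρ _ W hW
    refine resDerivable_restrict_of_isResRefutation hπ ρ fun l hl hns => ?_
    obtain ⟨i, hi, rfl⟩ := List.mem_iff_getElem.1 hl
    exact hW ⟨i, hi⟩ hns
  have hmain := derivable_of_fat_lt (clauseSet φ) (fun i : Fin π.length => (π[i]).clause) V hk hd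
    hR V.card ρ₀ (fun v hv => (hρ₀none v).1 hv) (Finset.card_le_card (Finset.filter_subset _ _))
    a (lt_of_le_of_lt (by
      refine mul_le_mul_of_nonneg_right ?_ (pow_nonneg ?_ _)
      · have := Finset.card_le_univ (univ.filter fun i : Fin π.length => IsFat d ρ₀ (π[i]).clause)
        rw [Fintype.card_fin] at this
        exact_mod_cast this
      · rcases Nat.eq_zero_or_pos V.card with hV | hV
        · have : d = 0 := by omega
          simp [hV, this]
        · rw [sub_nonneg, div_le_one (by positivity)]
          exact_mod_cast hd) hlt)
  -- `φ|ρ₀ = φ`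
  have hset : restrictFormula ρ₀ (clauseSet φ) = clauseSet φ := by
    have hnone : ∀ C ∈ clauseSet φ, ∀ l ∈ C, ρ₀ l.1 = none := by
      intro C hC l hl
      obtain ⟨c, hc, rfl⟩ := mem_clauseSet_iff.1 hC
      exact (hρ₀none _).2 (hφV c hc l (List.mem_toFinset.1 hl))
    have hid : ∀ C ∈ clauseSet φ, restrictClause ρ₀ C = C := fun C hC =>
      Finset.filter_true_of_mem (hnone C hC)
    have hns : ∀ C ∈ clauseSet φ, ¬ SatisfiedBy ρ₀ C := fun C hC ⟨l, hl, e⟩ => by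
      rw [hnone C hC l hl] at e; simp at e
    ext C
    constructor
    · rintro ⟨D, hD, -, rfl⟩
      rwa [hid D hD]
    · intro hC
      exact ⟨C, hC, hns C hC, hid C hC⟩
  rw [hset] at hmain
  exact hnd hmain

/-- **BSW Corollary 3.6 (size lower bound from width).** Under the hypotheses of
`one_le_length_mul_pow_of_not_derivable`, every refutation has at least `exp(a d / 2|V|)` lines.
[Ben-Sasson–Wigderson 2001, Cor. 3.6] [cite: BenSassonWigderson2001, Cor. 3.6] -/
theorem exp_le_length_of_not_derivable {φ : CNF ν} {π : List (ResLine ν)}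
    (hπ : IsResRefutation φ π) (V : Finset ν) (hφV : ∀ c ∈ φ, ∀ l ∈ c, l.1 ∈ V) {k : ℕ}
    (hk : ∀ D ∈ clauseSet φ, D.card ≤ k) {d : ℕ} (a : ℕ) (hd : d ≤ 2 * V.card)
    (hnd : ¬ ResDerivable (clauseSet φ) (d + a + k) ∅) :
    Real.exp (a * d / (2 * V.card)) ≤ π.length := by
  have h1 := one_le_length_mul_pow_of_not_derivable hπ V hφV hk a hd hnd
  have hθ : (1 - (d : ℝ) / (2 * V.card)) ^ a ≤ Real.exp (-(a * d / (2 * V.card))) := by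
    have hθ0 : (0 : ℝ) ≤ 1 - d / (2 * V.card) := by
      rcases Nat.eq_zero_or_pos V.card with hV | hV
      · have : d = 0 := by omega
        simp [hV, this]
      · rw [sub_nonneg, div_le_one (by positivity)]
        exact_mod_cast hd
    calc (1 - (d : ℝ) / (2 * V.card)) ^ a ≤ (Real.exp (-(d / (2 * V.card)))) ^ a :=
          pow_le_pow_left₀ hθ0 (Real.one_sub_le_exp_neg _) a
      _ = Real.exp (-(a * d / (2 * V.card))) := by
          rw [← Real.exp_nat_mul]; congr 1; ring
  have h2 : (1 : ℝ) ≤ π.length * Real.exp (-(a * d / (2 * V.card))) :=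
    h1.trans (mul_le_mul_of_nonneg_left hθ (Nat.cast_nonneg _))
  rw [Real.exp_neg] at h2
  have hpos := Real.exp_pos (a * d / (2 * (V.card : ℝ)))
  rw [← div_eq_mul_inv, le_div_iff₀ hpos, one_mul] at h2
  exact h2

end Literature.Computability.MetaComplexity
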